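import Summits.RiemannHypothesis.RiemannHypothesis.Theorems.Splittings.LiIndexSetsRecurrentFor
import Literature.NumberTheory.LFunctions.RiemannHypothesisUpTo101
import HarnessLib

/-!
# Splittings — Li index sets, part 5/5: SYNDETIC index sets, GIVEN the low zeros —
# `RH ⟺ λ_n ≥ 0 for all odd n`, and `RH ⟺ λ_n ≥ 0 on any residue class a mod q, q ≤ 20` (standard axioms)

Cell rh-split, seat rh-split-li-neg g2 (brief sha16 f79c5f09d8bcb036), card `run/shared/lean/pub/rh-split/cards/SPLIT-li-neg.md` §8
(Part F).  At the zeta level the members of the Bombieri–Lagarias family outside the unit disc are the hypothetical zeros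
with `Re ρ < 1/2`; by a verified zero-free height `RiemannHypothesisUpTo H` they have `|Im ρ| > H`, hence SLOW phases,
and every index set with gaps `≤ H/5` is recurrent for them (part 4/5, `recurrentFor_of_gaps`).  The multiset-level
criterion on such sets is FALSE (`not_multisetLiCriterionOn_odd`, part 3/5: the `2`-Beurling family): here the finite
verification is LOAD-BEARING — the first index-restricted Li criterion of the cell that is NOT a multiset-level theorem,
and the `∨` of the dichotomy BP-6 becomes an `∧` for odd/even.

* `exists_tsum_neg_pos_of_recurrentFor` — the `+n` (Li) form of part 4's Bombieri–Lagarias theorem along a set recurrent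
  for the reflected family `1 − ρ̄`; `riemannHypothesis_of_liPosOn_of_recurrentFor` — Li positivity on a set recurrent for the (reflected) zeros ⟹ RH;
* `recurrentFor_zetaZeros_of_gaps` — the zeros of `ζ` make every index set with gaps `≤ H/5` recurrent, GIVEN the zeros
  up to height `H`; `riemannHypothesis_of_liPosOn_of_gaps`, `riemannHypothesis_iff_liPosOn_of_rhUpTo` — the SPLITTING
  `RiemannHypothesisUpTo H ∧ [λ_n ≥ 0 on a set with gaps ≤ H/5] ⟹ RH` in which the FINITE conjunct is genuinely used;
* with the tree's unconditional `riemannHypothesisUpTo_hundredOne` (interval arithmetic, standard axioms):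
  `riemannHypothesis_iff_liPosOn_of_gaps_le_20` (every index set with gaps ≤ 20 carries an RH-equivalent Li criterion),
  **`riemannHypothesis_iff_liPosOn_odd` / `riemannHypothesis_iff_keiperLiCoeff_odd_nonneg` — `RH ⟺ ∀ n odd, 0 ≤ λ_n`**,
  `riemannHypothesis_iff_liPosOn_residueClass` (any class `a mod q`, `q ≤ 20`, incl. `a ≢ 0` — li-finite's V16 target),
  `riemannHypothesis_iff_liPosOn_odd_and_even`.

Deliberately NOT here: the `q ≤ 20000` / gaps `≤ 20000` variants of the scratch, which run through the COMPILED certificate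
`riemannHypothesisUpTo_100000` (`native_decide` auxiliary axioms); they stay in the seat's scratch.

References: [BombieriLagarias1999] Thm. 1; [Li1997].

Provenance: cell rh-split, seat rh-split-li-neg g2, scratch `HOME/rh-split-li-neg/LiIndexSets.lean` v2 (sha16
c74f7d64217f426c, 1294 lines, card addendum §8; proofs verbatim), Part F re-homed by rh-split-typer-1 g2 as parts 4/5
(`LiIndexSetsRecurrentFor`) and 5/5 (this file, no new definitions) of the `LiIndexSets*` package (parts 1–3 = p468824,
p469481, p470136), on the lead's priority list 2026-08-26T22:06Z (rh-split-lead g2: «FIN(101) load-bearing — cite the tree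
height-101 fact by name, no new axioms»).  Typer-1 g2 replay: farm rc 0, 0 warnings, 0 sorry,
`#print axioms riemannHypothesis_iff_keiperLiCoeff_odd_nonneg` = [propext, Classical.choice, Quot.sound].

HONEST LABEL: «SPLITTING SEARCH over kernel-typed RH-EQUIVALENCES; a splitting A ∧ B ⟹ RH is CONDITIONAL
bookkeeping unless A and B are both proved; nothing here bears on the truth of RH.»
-/

set_option linter.dupNamespace false

noncomputable section

open Complex Filter Topology Set
open scoped ComplexConjugate Real

namespace Summit.RiemannHypothesis.RiemannHypothesis.Theorems.Splittings.LiIndexSets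

open Literature.NumberTheory.LFunctions
open Literature.NumberTheory.LFunctions.BombieriLagarias
open Literature.NumberTheory.DiophantineGeometry (RiemannHypothesisUpTo)
open Summit.RiemannHypothesis.RiemannHypothesis.Theorems.Splittings

/-! ## The `+n` (Li) form of Bombieri–Lagarias along a set recurrent for the reflected family -/

section BL

variable {ι : Type*} {ρ : ι → ℂ} {m : ι → ℕ}

/-- **The `+n` (Li) form, contrapositive, along a set recurrent for the reflected family `1 − ρ̄`**: a member
with `Re ρ_{i₀} < 1/2` forces a negative Li sum at some index `n ∈ S` (tree `re_term_one_sub_conj`).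
[cite: BombieriLagarias1999, Theorem 1; Li2004, Theorem 2 and p. 494] -/
theorem exists_tsum_neg_pos_of_recurrentFor (hm : ∀ i, 0 < m i) (h0 : ∀ i, ρ i ≠ 0) (h1 : ∀ i, ρ i ≠ 1)
    (hR : Summable (weight (fun i ↦ 1 - conj (ρ i)) m)) {i₀ : ι} (hi₀ : (ρ i₀).re < 1 / 2)
    {S : Set ℕ} (hS : RecurrentFor (fun i ↦ 1 - conj (ρ i)) S) :
    ∃ n ∈ S, 1 ≤ n ∧ ∑' i, (m i : ℝ) * (1 - (1 - 1 / ρ i) ^ n).re < 0 := by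
  have h1' : ∀ i, 1 - conj (ρ i) ≠ 1 := by
    intro i h
    apply h0 i
    have : conj (ρ i) = 0 := by linear_combination -h
    simpa using this
  have hi₀' : 1 / 2 < ((fun i ↦ 1 - conj (ρ i)) i₀).re := by
    simp only [sub_re, one_re, Complex.conj_re]; linarith
  obtain ⟨n, hnS, hn1, hlt⟩ :=
    exists_tsum_neg_of_recurrentFor (ρ := fun i ↦ 1 - conj (ρ i)) hm h1' hR hi₀' hS
  refine ⟨n, hnS, hn1, ?_⟩
  simp only [re_term_one_sub_conj (h0 _) (h1 _)] at hlt
  exact hlt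

end BL

/-! ## Zeta-level helpers (as in part 3/5; private there) -/

/-- Cast bookkeeping for the order of a nontrivial zero. -/
private theorem toNat_cast_eq (ρ : ZetaZeros.riemannZetaNontrivialZeros) :
    (((riemannZetaZeroOrder (ρ : ℂ)).toNat : ℕ) : ℝ) = (riemannZetaZeroOrder (ρ : ℂ) : ℝ) := by
  have h := ZetaZeros.riemannZetaNontrivialZeros.one_le_order ρ.2
  have : ((riemannZetaZeroOrder (ρ : ℂ)).toNat : ℤ) = riemannZetaZeroOrder (ρ : ℂ) :=
    Int.toNat_of_nonneg (by omega)
  exact_mod_cast this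

/-- Nontrivial zeros are `≠ 0`. -/
private theorem ne_zero_of_mem (ρ : ZetaZeros.riemannZetaNontrivialZeros) : (ρ : ℂ) ≠ 0 := by
  intro h
  have := ZetaZeros.riemannZetaNontrivialZeros.re_pos ρ.2
  rw [h] at this
  simp at this

/-- `Re ρ ≥ 1/2` for all nontrivial zeros gives RH (pairing `ρ ↦ 1 - conj ρ`). -/
private theorem riemannHypothesis_of_forall_half_le_re
    (h : ∀ ρ ∈ ZetaZeros.riemannZetaNontrivialZeros, 1 / 2 ≤ ρ.re) : _root_.RiemannHypothesis := by
  intro s hs htriv _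
  have hmem : s ∈ ZetaZeros.riemannZetaNontrivialZeros := by
    refine ⟨hs, ?_⟩
    rintro ⟨k, hk⟩
    exact htriv ⟨k, hk.symm⟩
  have hge := h s hmem
  have hle := h (1 - conj s) (ZetaZeros.riemannZetaNontrivialZeros.one_sub_conj_mem hmem)
  simp only [sub_re, one_re, Complex.conj_re] at hle
  linarith



/-- **Li positivity on a set recurrent for the (reflected) zeros implies RH** — the zeta-level form with
the weakest recurrence hypothesis: only finite sets of hypothetical zeros with `Re ρ < 1/2` matter.
[cite: BombieriLagarias1999, Theorem 1; Li1997, (1.4)] -/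
theorem riemannHypothesis_of_liPosOn_of_recurrentFor {S : Set ℕ}
    (hS : RecurrentFor (fun ρ : ZetaZeros.riemannZetaNontrivialZeros ↦ 1 - conj (ρ : ℂ)) S)
    (h : LiPosOn S) : _root_.RiemannHypothesis := by
  refine riemannHypothesis_of_forall_half_le_re fun ρ hρ ↦ ?_
  by_contra hlt
  rw [not_le] at hlt
  obtain ⟨n, hnS, hn1, hneg⟩ := exists_tsum_neg_pos_of_recurrentFor
    (ρ := fun ρ : ZetaZeros.riemannZetaNontrivialZeros ↦ (ρ : ℂ))
    (m := fun ρ ↦ (riemannZetaZeroOrder (ρ : ℂ)).toNat)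
    (fun ρ ↦ by have := ZetaZeros.riemannZetaNontrivialZeros.one_le_order ρ.2; omega)
    (fun ρ ↦ ne_zero_of_mem ρ) (fun ρ ↦ ZetaZeros.riemannZetaNontrivialZeros.ne_one ρ.2)
    summable_weight_zetaZeros (i₀ := ⟨ρ, hρ⟩) hlt hS
  have hpos := h n hnS hn1
  rw [tsum_congr fun ρ ↦ by rw [toNat_cast_eq], ← keiperLiCoeff_eq_tsum_zeros hn1] at hneg
  linarith

/-! ## Syndetic index sets, GIVEN the low zeros: `RH ⟺ λ_n ≥ 0 for all odd n`

At the zeta level the members outside the unit disc are the hypothetical zeros with `Re ρ < 1/2`; by the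
verified zero-free height `RiemannHypothesisUpTo H` they have `|Im ρ| > H`, hence SLOW phases, and every
index set with gaps `≤ H/5` is recurrent for them.  The multiset-level criterion on such sets is FALSE
(`not_multisetLiCriterionOn_odd`): here the finite verification is LOAD-BEARING. -/

/-- From `RiemannHypothesisUpTo H`: every non-trivial zero with `|Im ρ| ≤ H` is on the line
(conjugation handles `Im ρ < 0`; cf. tree `CostumeDetectors.rh_of_rhUpTo_of_rhAbove`). -/
theorem re_eq_half_of_abs_im_le {H : ℝ} (hA : RiemannHypothesisUpTo H) {ρ : ℂ}
    (hρ : ρ ∈ ZetaZeros.riemannZetaNontrivialZeros) (hH : |ρ.im| ≤ H) : ρ.re = 1 / 2 := by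
  have him := ZetaZeros.riemannZetaNontrivialZeros.im_ne_zero hρ
  rcases lt_or_gt_of_ne him with hneg | hpos
  · have hmem' := ZetaZeros.riemannZetaNontrivialZeros.conj_mem hρ
    have hz' := ZetaZeros.riemannZetaNontrivialZeros.zeta_eq_zero hmem'
    have h1 : 0 < (conj ρ).im := by simp; linarith
    have h2 : (conj ρ).im ≤ H := by
      simp only [Complex.conj_im]
      have : |ρ.im| = -ρ.im := abs_of_neg hneg
      linarith
    have := hA (conj ρ) hz' h1 h2
    simpa using this
  · have h2 : ρ.im ≤ H := by
      have : |ρ.im| = ρ.im := abs_of_pos hpos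
      linarith
    exact hA ρ (ZetaZeros.riemannZetaNontrivialZeros.zeta_eq_zero hρ) hpos h2

/-- **The zeros of ζ make every index set with gaps `≤ H/5` recurrent, given the zeros up to height `H`.** -/
theorem recurrentFor_zetaZeros_of_gaps {H : ℝ} (hHpos : 0 < H)
    (hlow : ∀ ρ ∈ ZetaZeros.riemannZetaNontrivialZeros, |ρ.im| ≤ H → ρ.re = 1 / 2)
    {S : Set ℕ} {g : ℕ} (hS : HasGapsLe S g) (hg : 5 * (g : ℝ) ≤ H) :
    RecurrentFor (fun ρ : ZetaZeros.riemannZetaNontrivialZeros ↦ 1 - conj (ρ : ℂ)) S := by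
  have h0 : ∀ ρ : ZetaZeros.riemannZetaNontrivialZeros, 1 - conj (ρ : ℂ) ≠ 0 := by
    intro ρ h
    apply ZetaZeros.riemannZetaNontrivialZeros.ne_one ρ.2
    have : conj (ρ : ℂ) = 1 := by linear_combination -h
    simpa using congrArg conj this
  have h1 : ∀ ρ : ZetaZeros.riemannZetaNontrivialZeros, 1 - conj (ρ : ℂ) ≠ 1 := by
    intro ρ h
    apply ne_zero_of_mem ρ
    have : conj (ρ : ℂ) = 0 := by linear_combination -h
    simpa using this
  refine recurrentFor_of_gaps h0 h1 hHpos (fun ρ hw ↦ ?_) hS hg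
  have hre : (ρ : ℂ).re < 1 / 2 := by
    have := (one_lt_norm_inv_one_sub_inv_iff (h1 ρ)).1 hw
    simp only [sub_re, one_re, Complex.conj_re] at this
    linarith
  have hgt : H < |(ρ : ℂ).im| := by
    by_contra hle
    exact absurd (hlow ρ ρ.2 (not_lt.1 hle)) hre.ne
  calc H ≤ |(ρ : ℂ).im| := hgt.le
    _ ≤ ‖(ρ : ℂ)‖ := Complex.abs_im_le_norm _
    _ = ‖(1 - conj (ρ : ℂ)) - 1‖ := by rw [sub_sub_cancel_left, norm_neg, Complex.norm_conj]

/-- **Li positivity on any index set with gaps `≤ H/5` implies RH, given the zeros up to height `H`.**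
The first index-restricted Li criterion that is NOT a multiset-level theorem (it fails for the
`2`-Beurling family on the odd numbers): the verified low zeros are used, to make the phases slow. -/
theorem riemannHypothesis_of_liPosOn_of_gaps {H : ℝ} (hHpos : 0 < H)
    (hlow : ∀ ρ ∈ ZetaZeros.riemannZetaNontrivialZeros, |ρ.im| ≤ H → ρ.re = 1 / 2)
    {S : Set ℕ} {g : ℕ} (hS : HasGapsLe S g) (hg : 5 * (g : ℝ) ≤ H) (h : LiPosOn S) :
    _root_.RiemannHypothesis :=
  riemannHypothesis_of_liPosOn_of_recurrentFor (recurrentFor_zetaZeros_of_gaps hHpos hlow hS hg) h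

/-- `RiemannHypothesisUpTo H ∧ [λ_n ≥ 0 on a set with gaps ≤ H/5] → RH`, and conversely RH gives the
second conjunct: the splitting in which the FINITE conjunct is genuinely used. -/
theorem riemannHypothesis_iff_liPosOn_of_rhUpTo {H : ℝ} (hA : RiemannHypothesisUpTo H) (hHpos : 0 < H)
    {S : Set ℕ} {g : ℕ} (hS : HasGapsLe S g) (hg : 5 * (g : ℝ) ≤ H) :
    _root_.RiemannHypothesis ↔ LiPosOn S :=
  ⟨fun h n _ hn ↦ (li_criterion_holds.1 h) n hn,
    riemannHypothesis_of_liPosOn_of_gaps hHpos (fun _ hρ hle ↦ re_eq_half_of_abs_im_le hA hρ hle) hS hg⟩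

/-- With the tree's unconditional `riemannHypothesisUpTo_hundredOne` (interval arithmetic, standard
axioms): **every index set with gaps ≤ 20 carries an RH-equivalent Li criterion.** -/
theorem riemannHypothesis_iff_liPosOn_of_gaps_le_20 {S : Set ℕ} {g : ℕ} (hS : HasGapsLe S g)
    (hg : g ≤ 20) : _root_.RiemannHypothesis ↔ LiPosOn S :=
  riemannHypothesis_iff_liPosOn_of_rhUpTo riemannHypothesisUpTo_hundredOne (by norm_num) hS
    (by have : (g : ℝ) ≤ 20 := by exact_mod_cast hg
        linarith)

/-- The odd numbers have gaps `≤ 1`. [folklore] -/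
theorem hasGapsLe_odd : HasGapsLe {n | Odd n} 1 := by
  intro m
  rcases Nat.even_or_odd m with he | ho
  · exact ⟨m + 1, he.add_one, by omega, le_rfl⟩
  · exact ⟨m, ho, le_rfl, by omega⟩

/-- **RH ⟺ λ_n ≥ 0 for all odd n** (unconditional; uses the zeros up to height 101).  Contrast:
`not_isLiRecurrent_odd`, `not_multisetLiCriterionOn_odd` — for general multisets this is FALSE. -/
theorem riemannHypothesis_iff_liPosOn_odd : _root_.RiemannHypothesis ↔ LiPosOn {n | Odd n} :=
  riemannHypothesis_iff_liPosOn_of_gaps_le_20 hasGapsLe_odd (by norm_num)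

/-- RAW form: `RH ⟺ ∀ n odd, 0 ≤ λ_n`. -/
theorem riemannHypothesis_iff_keiperLiCoeff_odd_nonneg :
    _root_.RiemannHypothesis ↔ ∀ n : ℕ, Odd n → 0 ≤ keiperLiCoeff n :=
  riemannHypothesis_iff_liPosOn_odd.trans
    ⟨fun h n hn ↦ h n hn (by rcases hn with ⟨k, rfl⟩; omega), fun h n hn _ ↦ h n hn⟩

/-- A residue class `a mod q` (`q ≥ 1`) has gaps `≤ q`. [folklore] -/
theorem hasGapsLe_residueClass {q : ℕ} (hq : 1 ≤ q) (a : ℕ) : HasGapsLe {n | n % q = a % q} q := by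
  intro m
  refine ⟨m + (a % q + q - m % q) % q, ?_, by omega, by
    have := Nat.mod_lt (a % q + q - m % q) (by omega : 0 < q); omega⟩
  show (m + (a % q + q - m % q) % q) % q = a % q
  have hm : m % q < q := Nat.mod_lt m (by omega)
  rw [Nat.add_mod, Nat.mod_mod, Nat.add_mod_mod, show m % q + (a % q + q - m % q) = a % q + q by omega,
    Nat.add_mod_right, Nat.mod_mod]

/-- **RH ⟺ λ_n ≥ 0 on any residue class `a mod q`, `q ≤ 20`** (incl. `a ≢ 0`, where the multiset-level
criterion fails, `not_multisetLiCriterionOn_of_forall_not_dvd`). -/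
theorem riemannHypothesis_iff_liPosOn_residueClass {q : ℕ} (hq : 1 ≤ q) (hq20 : q ≤ 20) (a : ℕ) :
    _root_.RiemannHypothesis ↔ LiPosOn {n | n % q = a % q} :=
  riemannHypothesis_iff_liPosOn_of_gaps_le_20 (hasGapsLe_residueClass hq a) hq20

/-- The index dichotomy's `∨` can be an `∧`: BOTH the odd and the even Li coefficients give RH-equivalent
criteria (even = BP-1's progression `q = 2`, F1-free; odd = Part F, via the zeros to height 101). -/
theorem riemannHypothesis_iff_liPosOn_odd_and_even :
    (_root_.RiemannHypothesis ↔ LiPosOn {n | Odd n}) ∧ (_root_.RiemannHypothesis ↔ LiPosOn {n | Even n}) := by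
  refine ⟨riemannHypothesis_iff_liPosOn_odd, ?_⟩
  have h := riemannHypothesis_iff_liPosOn (isLiRecurrent_mul_tail (q := 2) (by norm_num) 0)
  refine ⟨fun hRH n _ hn ↦ (li_criterion_holds.1 hRH) n hn, fun hE ↦ h.2 fun n hn hn1 ↦ ?_⟩
  obtain ⟨k, -, rfl⟩ := hn
  exact hE (2 * k) ⟨k, by ring⟩ hn1

end Summit.RiemannHypothesis.RiemannHypothesis.Theorems.Splittings.LiIndexSets

end
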